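import Summits.NavierStokesRegularity.NavierStokesRegularity.Theses.TransitMassLedger
import HarnessLib

/-!
# Route TransitMassLedger, item `Assembly` (stmt-NavierStokesRegularity-24401)

The route's assembly: the five route statements `ActionTransitExtraction`, `LedgerRigidity`,
`BackscatterRigidity`, `NoLoudLadderOne`, `EternalRigidityViscBddOne` imply the rung target
`TaoLadderRungTwoBreak.Target` — verbatim the curried form of the route's deciding theorem
`TransitMassLedger.closes` (planner-authored, kernel-checked in the route file).

MODEL lattice bookkeeping (Tao 2016 §4 renormalised cascade); nothing here bears on the
Navier–Stokes equations.
-/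

set_option linter.dupNamespace false

namespace Summit.NavierStokesRegularity.NavierStokesRegularity.Theorems

/-- **`TransitMassLedger.Assembly`** (stmt-NavierStokesRegularity-24401): the curried deciding
theorem of the route. [folklore] -/
theorem transitMassLedger_assembly_proof :
    Summit.NavierStokesRegularity.NavierStokesRegularity.Theses.TransitMassLedger.Assembly :=
  -- (buildfix 2026-08-28) the route's `closes` was re-keyed (13:4x) to seven binders (BackscatterRigidity split
  -- into IncrementBoundRigidity / CertifiedIncrementBound / ResidualIncrementBound); this CLOSED assembly keeps
  -- its accepted five-binder statement, so the pre-edit chain of `closes` is inlined: degree-1 tables by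
  -- LedgerRigidity, all others by BackscatterRigidity, then the eternal-rigidity door of the rung.
  fun h1 h2 h3 h4 h5 => by
    intro R hR
    have h0 : Literature.Analysis.FluidPDE.TaoCascade.NoSurvivingEternalBdd R 1 := by
      by_contra h
      obtain ⟨α, hα, V, hl, hb, hc, hs, hf, hbk, hact, n, s, hne⟩ := h1 R hR h
      by_cases hdeg : ∃ (ℓ : EuclideanSpace ℝ (Fin 4)) (θ : EuclideanSpace ℝ (Fin 4) → ℝ) (κ : ℝ), 0 < κ ∧
          Continuous θ ∧ θ 0 = 0 ∧ ∀ x y : EuclideanSpace ℝ (Fin 4), ‖x‖ ≤ 1 → ‖y‖ ≤ 1 →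
            κ * ‖Literature.Analysis.FluidPDE.TaoCascade.tableA α x -
              Literature.Analysis.FluidPDE.TaoCascade.tableA α y‖ ^ 2 ≤
              inner ℝ ℓ (Literature.Analysis.FluidPDE.TaoCascade.tableQ α x +
                Literature.Analysis.FluidPDE.TaoCascade.tableA α x +
                Literature.Analysis.FluidPDE.TaoCascade.tableB α y x) + θ x - θ y
      · obtain ⟨ℓ, θ, κ, hκ, hθc, hθ0, hM⟩ := hdeg
        exact hne (h2 R hR α hα ℓ θ κ hκ hθc hθ0 hM V hl hb hc hs hf hbk hact n s)
      · exact hne (h3 R hR α hα hdeg V hl hb hc hs hf hbk hact n s)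
    exact Literature.Analysis.FluidPDE.TaoCascade.noRobustBlowupBelow_of_eternalViscBdd
      (Literature.Analysis.FluidPDE.TaoCascade.noSurvivingEternalViscBddOne_of h0 (h4 R hR)) (h5 R hR)

end Summit.NavierStokesRegularity.NavierStokesRegularity.Theorems
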